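import Literature.NumberTheory.Automorphic.UnitaryGroupArthurTruncatedTrace
import HarnessLib

/-!
# From constant logarithmic differences to Arthur's degree-`≤ 1` polynomial: `J^T(f) = a + b log T`
(Arthur, *The trace formula in invariant form*, Ann. of Math. 114 (1981), Prop. 2.3; Rogawski, *Automorphic
Representations of Unitary Groups in Three Variables* (1990), §2.1 p. 12 «each term is a polynomial in `T`»;
Shokranian, *The Selberg–Arthur Trace Formula* (1992), Thm. (5.7), Rem. (5.8)(a): degree `dim(A_B/A_G) = 1`.)

Topic `NumberTheory/Automorphic`; namespace `Literature.NumberTheory.Automorphic.UnitaryGroup`. THEOREMS ONLY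
over accepted tree modules: no definition, no named fact, no instance, no notation, no `sorry`. Row (L2-z) «THE
LAST STEP» of the T1-qs LAW 2 road (named fact ★ `UnitaryGroup.TruncatedTracePolynomial` of
`UnitaryGroupArthurTruncatedTrace`) of the engine line `Cruxes/H413/Lines/F0_T1InnerFormTraceIdentity.lean`.

THE POINT. The road (F0P3a-p04 (g5), (L2-a)…(L2-e)) computes the DIFFERENCES of Arthur's distribution in the
rank-one case: above the integrability threshold `T₀` of ★ `TruncatedKernelIntegrable`,
`J^{T′}(f) − J^{T}(f) = D_f · (log T′ − log T)` for `T₀ < T ≤ T′`, with ONE constant `D_f ∈ ℂ` (the torus ray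
integral of the window is translation invariant in `log T`). This file turns that difference law into the
printed statement «`J^T(f) = p(log T)` with `deg p ≤ 1`»:

* §1 `exists_polynomial_natDegree_le_one_of_sub_eq_mul_log_sub` — pure algebra: a function `J : ℝ≥0 → ℂ` with
  `J T′ − J T = D (log T′ − log T)` for `T₀ < T ≤ T′` equals `p(log T)` for `T > T₀`, where
  `p = D·X + (J T₁ − D log T₁)` (`T₁ = T₀ + 1`), `natDegree p ≤ 1` (Mathlib `Polynomial.natDegree_linear_le`);
  variant `…_of_one_le` for a law lettered on `1 ≤ T ≤ T′`.
* §2 `exists_isTruncatedTracePolynomial_of_sub_eq_mul_log_sub` — the same for `J T := truncatedTrace μ ν 𝓕 T f`: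
  `∃ p, natDegree p ≤ 1 ∧ IsTruncatedTracePolynomial μ ν 𝓕 f p` (any `N`).
* §3 **`truncatedTracePolynomial_of_forall_exists_sub_eq_mul_log_sub`** — THE LAW-SHAPED CLOSER for `U(J₃)`: if
  for every `(ν, 𝓕, μ, f)` as in the named fact there are `T₀, D` with the difference law, then
  `TruncatedTracePolynomial F E c` holds; so the assembly (L2-e) ends with one `exact`.

## References
* J. Arthur, *The trace formula in invariant form*, Ann. of Math. 114 (1981), Prop. 2.3 [Arthur1981TraceFormulaInvariantForm].
* J. D. Rogawski, *Automorphic Representations of Unitary Groups in Three Variables*, Ann. of Math. Stud. 123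
  (1990), §2.1 (p. 12) [Rogawski1990].
* S. Shokranian, *The Selberg–Arthur Trace Formula*, LNM 1503 (1992), Thm. (5.7), Rem. (5.8) [Shokranian1992].
-/

set_option autoImplicit false

noncomputable section

open MeasureTheory NumberField IsDedekindDomain Polynomial
open scoped NNReal ENNReal

namespace Literature.NumberTheory.Automorphic

namespace UnitaryGroup

variable {F E : Type} [Field F] [NumberField F] [Field E] [NumberField E] [Algebra F E]
  {c : E ≃ₐ[F] E} {N : ℕ}

/-! ## §1 Pure algebra: constant logarithmic differences above a threshold -/

/-- **A function with constant logarithmic differences above a threshold is affine in `log T` there.**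
If `J T′ − J T = D · (log T′ − log T)` whenever `T₀ < T ≤ T′`, then with `T₁ := T₀ + 1` and
`p := D·X + (J T₁ − D log T₁)` one has `natDegree p ≤ 1` and `J T = p(log T)` for all `T > T₀` (compare `T`
with `T₁` and apply the hypothesis to the ordered pair). [cite: Arthur1981TraceFormulaInvariantForm, Prop. 2.3] -/
theorem exists_polynomial_natDegree_le_one_of_sub_eq_mul_log_sub {J : ℝ≥0 → ℂ} {T₀ : ℝ≥0} {D : ℂ}
    (h : ∀ T T' : ℝ≥0, T₀ < T → T ≤ T' →
      J T' - J T = D * (((Real.log (T' : ℝ) - Real.log (T : ℝ) : ℝ)) : ℂ)) :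
    ∃ p : ℂ[X], p.natDegree ≤ 1 ∧ ∀ T : ℝ≥0, T₀ < T → J T = p.eval (((Real.log (T : ℝ)) : ℝ) : ℂ) := by
  set T₁ : ℝ≥0 := T₀ + 1 with hT₁
  have hT₀₁ : T₀ < T₁ := by rw [hT₁]; exact lt_add_one T₀
  refine ⟨C D * X + C (J T₁ - D * ((Real.log (T₁ : ℝ) : ℝ) : ℂ)), natDegree_linear_le, fun T hT => ?_⟩
  rw [eval_add, eval_mul, eval_C, eval_X, eval_C]
  rcases le_total T T₁ with hle | hle
  · have h1 := h T T₁ hT hle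
    rw [Complex.ofReal_sub] at h1
    linear_combination (-1 : ℂ) * h1
  · have h1 := h T₁ T hT₀₁ hle
    rw [Complex.ofReal_sub] at h1
    linear_combination h1

/-- The same for a difference law lettered on `1 ≤ T ≤ T′` (then `J T = p(log T)` for all `T ≥ 1`, in
particular for all `T > 1`). [cite: Arthur1981TraceFormulaInvariantForm, Prop. 2.3] -/
theorem exists_polynomial_natDegree_le_one_of_sub_eq_mul_log_sub_of_one_le {J : ℝ≥0 → ℂ} {D : ℂ}
    (h : ∀ T T' : ℝ≥0, 1 ≤ T → T ≤ T' →
      J T' - J T = D * (((Real.log (T' : ℝ) - Real.log (T : ℝ) : ℝ)) : ℂ)) :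
    ∃ p : ℂ[X], p.natDegree ≤ 1 ∧ ∀ T : ℝ≥0, 1 ≤ T → J T = p.eval (((Real.log (T : ℝ)) : ℝ) : ℂ) := by
  refine ⟨C D * X + C (J 1), natDegree_linear_le, fun T hT => ?_⟩
  rw [eval_add, eval_mul, eval_C, eval_X, eval_C]
  have h1 := h 1 T le_rfl hT
  rw [Complex.ofReal_sub, NNReal.coe_one, Real.log_one, Complex.ofReal_zero, sub_zero] at h1
  linear_combination h1

/-! ## §2 Arthur's polynomial from the difference law -/

section TruncatedTrace

variable [NeZero N] [MeasurableSpace (adelicUnipotent F E c N)]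

/-- **`J^T(f) = p(log T)` with `deg p ≤ 1` from the difference law**: if
`J^{T′}(f) − J^{T}(f) = D · (log T′ − log T)` for `T₀ < T ≤ T′`, then Arthur's distribution is computed above
`T₀` by a polynomial of degree `≤ 1` in `log T` (`IsTruncatedTracePolynomial`). [cite: Rogawski1990, §2.1 (p. 12)]
[cite: Shokranian1992, Thm. (5.7) and Rem. (5.8)] -/
theorem exists_isTruncatedTracePolynomial_of_sub_eq_mul_log_sub
    (μ : Measure (quasiSplit F E c N).automorphicQuotient) (ν : Measure (adelicUnipotent F E c N))
    (𝓕 : Set (adelicUnipotent F E c N)) (f : (quasiSplit F E c N).Adelic → ℂ) {T₀ : ℝ≥0} {D : ℂ}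
    (h : ∀ T T' : ℝ≥0, T₀ < T → T ≤ T' →
      truncatedTrace μ ν 𝓕 T' f - truncatedTrace μ ν 𝓕 T f =
        D * (((Real.log (T' : ℝ) - Real.log (T : ℝ) : ℝ)) : ℂ)) :
    ∃ p : ℂ[X], p.natDegree ≤ 1 ∧ IsTruncatedTracePolynomial μ ν 𝓕 f p := by
  obtain ⟨p, hp1, hp⟩ :=
    exists_polynomial_natDegree_le_one_of_sub_eq_mul_log_sub (J := fun T => truncatedTrace μ ν 𝓕 T f) h
  exact ⟨p, hp1, T₀, hp⟩

/-- The same from a difference law lettered on `1 ≤ T ≤ T′` (threshold `T₀ := 1`).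
[cite: Shokranian1992, Thm. (5.7) and Rem. (5.8)] -/
theorem exists_isTruncatedTracePolynomial_of_sub_eq_mul_log_sub_of_one_le
    (μ : Measure (quasiSplit F E c N).automorphicQuotient) (ν : Measure (adelicUnipotent F E c N))
    (𝓕 : Set (adelicUnipotent F E c N)) (f : (quasiSplit F E c N).Adelic → ℂ) {D : ℂ}
    (h : ∀ T T' : ℝ≥0, 1 ≤ T → T ≤ T' →
      truncatedTrace μ ν 𝓕 T' f - truncatedTrace μ ν 𝓕 T f =
        D * (((Real.log (T' : ℝ) - Real.log (T : ℝ) : ℝ)) : ℂ)) :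
    ∃ p : ℂ[X], p.natDegree ≤ 1 ∧ IsTruncatedTracePolynomial μ ν 𝓕 f p := by
  obtain ⟨p, hp1, hp⟩ :=
    exists_polynomial_natDegree_le_one_of_sub_eq_mul_log_sub_of_one_le (J := fun T => truncatedTrace μ ν 𝓕 T f) h
  exact ⟨p, hp1, 1, fun T hT => hp T hT.le⟩

/-- **A difference law above a threshold that also depends on a second threshold**: if the law holds for
`max T₀ T₀' < T ≤ T′` only (e.g. `T₀` from ★ `TruncatedKernelIntegrable` and `T₀' = 1` from the height
normalisation), the conclusion is the same. [cite: Shokranian1992, Thm. (5.7) and Rem. (5.8)] -/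
theorem exists_isTruncatedTracePolynomial_of_sub_eq_mul_log_sub_of_lt_of_le
    (μ : Measure (quasiSplit F E c N).automorphicQuotient) (ν : Measure (adelicUnipotent F E c N))
    (𝓕 : Set (adelicUnipotent F E c N)) (f : (quasiSplit F E c N).Adelic → ℂ) {T₀ T₀' : ℝ≥0} {D : ℂ}
    (h : ∀ T T' : ℝ≥0, T₀ < T → T₀' ≤ T → T ≤ T' →
      truncatedTrace μ ν 𝓕 T' f - truncatedTrace μ ν 𝓕 T f =
        D * (((Real.log (T' : ℝ) - Real.log (T : ℝ) : ℝ)) : ℂ)) :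
    ∃ p : ℂ[X], p.natDegree ≤ 1 ∧ IsTruncatedTracePolynomial μ ν 𝓕 f p :=
  exists_isTruncatedTracePolynomial_of_sub_eq_mul_log_sub μ ν 𝓕 f (T₀ := max T₀ T₀')
    fun T T' hT hTT' => h T T' (lt_of_le_of_lt (le_max_left _ _) hT) (le_of_lt (lt_of_le_of_lt (le_max_right _ _) hT)) hTT'

end TruncatedTrace

/-! ## §3 The law-shaped closer for `U(J₃)` -/

/-- **THE CLOSER OF LAW 2 (`TruncatedTracePolynomial`) FROM THE DIFFERENCE LAW.**  If for every Haar measure `ν`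
of `N(𝔸_F)`, every fundamental domain `𝓕` of `N(F)`, every automorphic measure `μ` and every test function `f`
there are a threshold `T₀` and a constant `D ∈ ℂ` with `J^{T′}(f) − J^{T}(f) = D (log T′ − log T)` for
`T₀ < T ≤ T′`, then `J^T(f)` is a polynomial of degree `≤ 1` in `log T` above a threshold — the named fact ★
`UnitaryGroup.TruncatedTracePolynomial F E c`. [cite: Rogawski1990, §2.1 (p. 12)]
[cite: Shokranian1992, Thm. (5.7) and Rem. (5.8)] [cite: Arthur1981TraceFormulaInvariantForm, Prop. 2.3] -/
theorem truncatedTracePolynomial_of_forall_exists_sub_eq_mul_log_sub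
    (h : ∀ [MeasurableSpace (adelicUnipotent F E c 3)] [BorelSpace (adelicUnipotent F E c 3)]
      (ν : Measure (adelicUnipotent F E c 3)) [ν.IsHaarMeasure]
      (𝓕 : Set (adelicUnipotent F E c 3)),
      IsFundamentalDomain (rationalUnipotent F E c 3) 𝓕 ν →
        ∀ (μ : Measure (quasiSplit F E c 3).automorphicQuotient)
          [(quasiSplit F E c 3).IsAutomorphicMeasure μ]
          (f : (quasiSplit F E c 3).Adelic → ℂ), IsQuasiSplitTest F E c 3 f →
          ∃ (T₀ : ℝ≥0) (D : ℂ), ∀ T T' : ℝ≥0, T₀ < T → T ≤ T' →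
            truncatedTrace μ ν 𝓕 T' f - truncatedTrace μ ν 𝓕 T f =
              D * (((Real.log (T' : ℝ) - Real.log (T : ℝ) : ℝ)) : ℂ)) :
    TruncatedTracePolynomial F E c := by
  intro _ _ ν _ 𝓕 h𝓕 μ _ f hf
  obtain ⟨T₀, D, hD⟩ := h ν 𝓕 h𝓕 μ f hf
  exact exists_isTruncatedTracePolynomial_of_sub_eq_mul_log_sub μ ν 𝓕 f hD

/-- The same closer from a difference law lettered on `1 ≤ T ≤ T′` above the integrability threshold
(`T₀ < T`, `1 ≤ T`, `T ≤ T′`). [cite: Shokranian1992, Thm. (5.7) and Rem. (5.8)] -/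
theorem truncatedTracePolynomial_of_forall_exists_sub_eq_mul_log_sub_of_one_le
    (h : ∀ [MeasurableSpace (adelicUnipotent F E c 3)] [BorelSpace (adelicUnipotent F E c 3)]
      (ν : Measure (adelicUnipotent F E c 3)) [ν.IsHaarMeasure]
      (𝓕 : Set (adelicUnipotent F E c 3)),
      IsFundamentalDomain (rationalUnipotent F E c 3) 𝓕 ν →
        ∀ (μ : Measure (quasiSplit F E c 3).automorphicQuotient)
          [(quasiSplit F E c 3).IsAutomorphicMeasure μ]
          (f : (quasiSplit F E c 3).Adelic → ℂ), IsQuasiSplitTest F E c 3 f →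
          ∃ (T₀ : ℝ≥0) (D : ℂ), ∀ T T' : ℝ≥0, T₀ < T → 1 ≤ T → T ≤ T' →
            truncatedTrace μ ν 𝓕 T' f - truncatedTrace μ ν 𝓕 T f =
              D * (((Real.log (T' : ℝ) - Real.log (T : ℝ) : ℝ)) : ℂ)) :
    TruncatedTracePolynomial F E c := by
  intro _ _ ν _ 𝓕 h𝓕 μ _ f hf
  obtain ⟨T₀, D, hD⟩ := h ν 𝓕 h𝓕 μ f hf
  exact exists_isTruncatedTracePolynomial_of_sub_eq_mul_log_sub_of_lt_of_le μ ν 𝓕 f hD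

end UnitaryGroup

end Literature.NumberTheory.Automorphic
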